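import Literature.Analysis.FluidPDE.OnsagerBDSVStressSplit
import Literature.Analysis.FluidPDE.OnsagerBDSVEnergy
import HarnessLib

/-!
# The BDSV oscillation error (§6.1.3) split into `𝒪₁ + 𝒪₂`

Buckmaster–De Lellis–Székelyhidi–Vicol (BDSV), *Onsager's conjecture for admissible weak
solutions*, CPAM 72 (2019) = arXiv:1701.08678, §6.1.3, estimate the oscillation error of the new
Reynolds stress, `ℛ div(w_{q+1} ⊗ w_{q+1} - R̄_q)` (the named fact `BDSV.oscillationErrorEstimate`
of `OnsagerBDSVStressSplit.lean`), by splitting it along `w_{q+1} = w_o + w_c` (arXiv (5.20),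
(5.27)–(5.28)):

  `ℛ div(-R̄_q + w_{q+1} ⊗ w_{q+1}) = ℛ div(-R̄_q + w_o ⊗ w_o) =: 𝒪₁`
  `                                  + ℛ div(w_o ⊗ w_c + w_c ⊗ w_o + w_c ⊗ w_c) =: 𝒪₂`,

bounding `𝒪₂` directly (arXiv (6.9): "`‖𝒪₂‖_α ≲ ‖w_o ⊗ w_c + w_c ⊗ w_o + w_c ⊗ w_c‖_α ≲
‖w_o‖₀‖w_c‖_α + ‖w_o‖_α‖w_c‖₀ + ‖w_c‖_α² ≲ δ_{q+1}/(ℓλ_{q+1}^{1-α}) ≲ …`", i.e. the Calderón–Zygmund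
bound for `ℛ div` and Cor. 5.8) and `𝒪₁` through the expansion arXiv (6.10) of `w_{o,i} ⊗ w_{o,i}`
and the stationary phase estimate Prop. C.2 (arXiv (6.11)), concluding "Clearly, (6.9) and (6.11)
give (6.12)". This file performs this split for the honest objects of the tree — the principal part
`w_o = BDSV.principalPart` and the corrector `w_c = w_{q+1} - w_o = BDSV.correctorPart` of
`OnsagerBDSVEnergy.lean`, `R̄_q = BDSV.stressSum`, `ℛ = Torus.antidivergence`:

* the two tensors `BDSV.oscPrincipalTensor = w_o ⊗ w_o - R̄_q`, `BDSV.oscCorrectorTensor =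
  w_o ⊗ w_c + w_c ⊗ w_o + w_c ⊗ w_c` (columns `u_j v` for `v ⊗ u`, as in `BDSV.stressSource`), with
  `w ⊗ w - R̄_q = oscPrincipalTensor + oscCorrectorTensor` (`BDSV.oscillationTensor_eq_add`) and their
  divergences `BDSV.oscPrincipalSource`, `BDSV.oscCorrectorSource`, so that
  `ℛ div(w ⊗ w - R̄_q) = 𝒪₁ + 𝒪₂` on `[0,T]` (`BDSV.SmoothData.antidivergence_oscillationSource_eq_add`,
  linearity of `div` and `ℛ` on smooth fields);
* the two printed estimates as NAMED FACTS along the common prefix `BDSV.StageFact`: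
  `BDSV.oscillationPrincipalEstimate` (`𝒪₁`, arXiv (6.11)) and `BDSV.oscillationCorrectorEstimate`
  (`𝒪₂`, arXiv (6.9)), `C^{0,α}` bounds on `[0,T]` by the scale
  `δ_{q+1}^{1/2} δ_q^{1/2} λ_q λ_{q+1}^{-(1-4α)}` of (6.1) — as for the three error facts of
  `OnsagerBDSVStressSplit.lean` ("Design choices" there): both printed displays end with
  `δ_{q+1}^{1/2} δ_q^{1/2} λ_q λ_{q+1}^{-(1-α)}` after the step
  "`δ_{q+1}/(ℓλ_{q+1}^{1-α}) ≲ δ_{q+1}^{1/2} δ_q^{1/2} λ_q/λ_{q+1}^{1-α}`", which drops the factor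
  `λ_q^{3α/2}` of `δ_{q+1}ℓ⁻¹ = δ_{q+1}^{1/2} δ_q^{1/2} λ_q^{1+3α/2}` ((2.19)); the exponent of (6.1)
  is the uniform-in-`q` content of both displays and is what §6.1.4 uses;
* the PROVED assembly `BDSV.oscillationErrorEstimate_of_parts :
  oscillationPrincipalEstimate → oscillationCorrectorEstimate → oscillationErrorEstimate`
  ("Clearly, (6.9) and (6.11) give (6.12)"), and `BDSV.oscillationErrorEstimate_iff_stageFact`.

## What is not here

The proofs of the two facts: `𝒪₂` from the `C^{0,α}`-boundedness of `ℛ div`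
(`BDSV.holder_antidivergence_tensorDivergence_le`, `AntidivergenceHolder.lean`), Hölder products
and the bounds of Cor. 5.8 on `w_o`, `w_c`; `𝒪₁` from `det ∇Φ_i = 1`, the Fourier expansion of
`W ⊗ W` (arXiv (5.6)–(5.7)), the identity (6.10), Prop. C.2 (`BDSV.antidivergencePhaseBound`) and
Prop. 5.7.

## References

* T. Buckmaster, C. De Lellis, L. Székelyhidi Jr., V. Vicol, *Onsager's conjecture for admissible
  weak solutions*, Comm. Pure Appl. Math. 72 (2019) 229–274 = arXiv:1701.08678, §6.1.3
  (arXiv (6.9)–(6.12)), §5.3 (arXiv (5.20), (5.27)–(5.28)), Cor. 5.8, App. C Props. C.1–C.2.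
  Equation numbers as in arXiv:1701.08678v1 (cf. `OnsagerBDSVStressSplit.lean`, "Numbering").
-/

open MeasureTheory Set
open scoped NNReal ENNReal ContDiff Matrix Matrix.Norms.Elementwise

noncomputable section

namespace Literature.Analysis.FluidPDE

namespace BDSV

open FunctionSpaces FunctionSpaces.Torus

/-- The flat three-torus `T³ = (ℝ/ℤ)³`, local notation. -/
local notation "𝕋³" => UnitAddTorus (Fin 3)

/-- Euclidean `ℝ³`, local notation. -/
local notation "ℝ³" => EuclideanSpace ℝ (Fin 3)

/-! ## The tensors `w_o ⊗ w_o - R̄_q` and `w_o ⊗ w_c + w_c ⊗ w_o + w_c ⊗ w_c` -/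

section Tensors

variable (P : Params) (S : Setting)

/-- The tensor `w_o ⊗ w_o - R̄_q` under `ℛ div` in `𝒪₁` (columns `(w_o)_j w_o - R̄_q e_j`).
[cite: BuckmasterEtAl2018, §6.1.3 (definition of 𝒪₁)] -/
def oscPrincipalTensor (𝔚 : MikadoDatum mikadoRadius) (η : ℕ → ℝ → 𝕋³ → ℝ) (D : ℕ → ℝ → 𝕋³ → ℝ³)
    (t : ℝ) (y : 𝕋³) (j : Fin 3) : ℝ³ :=
  principalPart P S 𝔚 η D t y j • principalPart P S 𝔚 η D t y - stressSum P S η t y j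

/-- The tensor `w_o ⊗ w_c + w_c ⊗ w_o + w_c ⊗ w_c` under `ℛ div` in `𝒪₂` (columns).
[cite: BuckmasterEtAl2018, §6.1.3 (definition of 𝒪₂)] -/
def oscCorrectorTensor (𝔚 : MikadoDatum mikadoRadius) (η : ℕ → ℝ → 𝕋³ → ℝ) (D : ℕ → ℝ → 𝕋³ → ℝ³)
    (t : ℝ) (y : 𝕋³) (j : Fin 3) : ℝ³ :=
  principalPart P S 𝔚 η D t y j • correctorPart P S 𝔚 η D t y +
    correctorPart P S 𝔚 η D t y j • principalPart P S 𝔚 η D t y +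
    correctorPart P S 𝔚 η D t y j • correctorPart P S 𝔚 η D t y

/-- The source `div(w_o ⊗ w_o - R̄_q)` of `𝒪₁ = ℛ div(w_o ⊗ w_o - R̄_q)`.
[cite: BuckmasterEtAl2018, §6.1.3 (definition of 𝒪₁)] -/
def oscPrincipalSource (𝔚 : MikadoDatum mikadoRadius) (η : ℕ → ℝ → 𝕋³ → ℝ) (D : ℕ → ℝ → 𝕋³ → ℝ³)
    (t : ℝ) (x : 𝕋³) : ℝ³ :=
  Torus.tensorDivergence (oscPrincipalTensor P S 𝔚 η D t) x

/-- The source `div(w_o ⊗ w_c + w_c ⊗ w_o + w_c ⊗ w_c)` of `𝒪₂`.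
[cite: BuckmasterEtAl2018, §6.1.3 (definition of 𝒪₂)] -/
def oscCorrectorSource (𝔚 : MikadoDatum mikadoRadius) (η : ℕ → ℝ → 𝕋³ → ℝ) (D : ℕ → ℝ → 𝕋³ → ℝ³)
    (t : ℝ) (x : 𝕋³) : ℝ³ :=
  Torus.tensorDivergence (oscCorrectorTensor P S 𝔚 η D t) x

variable {P S}

/-- `w ⊗ w - R̄_q = (w_o ⊗ w_o - R̄_q) + (w_o ⊗ w_c + w_c ⊗ w_o + w_c ⊗ w_c)` for `w = w_o + w_c`
(the split of §6.1.3, pointwise). [cite: BuckmasterEtAl2018, §6.1.3 (𝒪₁ + 𝒪₂)] -/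
theorem oscillationTensor_eq_add (𝔚 : MikadoDatum mikadoRadius) (η : ℕ → ℝ → 𝕋³ → ℝ)
    (D : ℕ → ℝ → 𝕋³ → ℝ³) (t : ℝ) :
    (fun y j => perturbation P S 𝔚 η D t y j • perturbation P S 𝔚 η D t y - stressSum P S η t y j) =
      fun y j => oscPrincipalTensor P S 𝔚 η D t y j + oscCorrectorTensor P S 𝔚 η D t y j := by
  funext y j
  simp only [oscPrincipalTensor, oscCorrectorTensor, perturbation_eq_principalPart_add_correctorPart,
    PiLp.add_apply, add_smul, smul_add]
  abel

end Tensors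

/-! ## Smoothness and the split of `ℛ div` -/

section Smooth

variable {P : Params} {S : Setting} {η : ℕ → ℝ → 𝕋³ → ℝ} {D : ℕ → ℝ → 𝕋³ → ℝ³}

namespace SmoothData

variable (h : SmoothData P S η D)
include h

/-- `w_o ⊗ w_o - R̄_q` is jointly smooth. [folklore] -/
theorem oscPrincipalTensor (𝔚 : MikadoDatum mikadoRadius) :
    IsSmoothSpaceTimeOn (Icc 0 S.T) (BDSV.oscPrincipalTensor P S 𝔚 η D) :=
  contDiffOn_pi' fun j => (((h.principalPart 𝔚).apply j).smul (h.principalPart 𝔚)).sub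
    (h.stressSum_column j)

/-- `w_o ⊗ w_c + w_c ⊗ w_o + w_c ⊗ w_c` is jointly smooth. [folklore] -/
theorem oscCorrectorTensor (𝔚 : MikadoDatum mikadoRadius) :
    IsSmoothSpaceTimeOn (Icc 0 S.T) (BDSV.oscCorrectorTensor P S 𝔚 η D) :=
  contDiffOn_pi' fun j =>
    ((((h.principalPart 𝔚).apply j).smul (h.correctorPart 𝔚)).add
      (((h.correctorPart 𝔚).apply j).smul (h.principalPart 𝔚))).add
      (((h.correctorPart 𝔚).apply j).smul (h.correctorPart 𝔚))

/-- The source of `𝒪₁` is jointly smooth. [folklore] -/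
theorem oscPrincipalSource (𝔚 : MikadoDatum mikadoRadius) :
    IsSmoothSpaceTimeOn (Icc 0 S.T) (BDSV.oscPrincipalSource P S 𝔚 η D) :=
  (h.oscPrincipalTensor 𝔚).tensorDivergence h.uniqueDiffOn

/-- The source of `𝒪₂` is jointly smooth. [folklore] -/
theorem oscCorrectorSource (𝔚 : MikadoDatum mikadoRadius) :
    IsSmoothSpaceTimeOn (Icc 0 S.T) (BDSV.oscCorrectorSource P S 𝔚 η D) :=
  (h.oscCorrectorTensor 𝔚).tensorDivergence h.uniqueDiffOn

/-- `div(w ⊗ w - R̄_q) = div(w_o ⊗ w_o - R̄_q) + div(w_o ⊗ w_c + w_c ⊗ w_o + w_c ⊗ w_c)` on `[0,T]`.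
[cite: BuckmasterEtAl2018, §6.1.3 (𝒪₁ + 𝒪₂)] -/
theorem oscillationSource_eq_add (𝔚 : MikadoDatum mikadoRadius) {t : ℝ} (ht : t ∈ Icc 0 S.T) :
    BDSV.oscillationSource P S 𝔚 η D t =
      fun x => BDSV.oscPrincipalSource P S 𝔚 η D t x + BDSV.oscCorrectorSource P S 𝔚 η D t x := by
  funext x
  rw [BDSV.oscillationSource, oscillationTensor_eq_add 𝔚 η D t]
  exact tensorDivergence_add ((h.oscPrincipalTensor 𝔚).isSmooth_slice ht)
    ((h.oscCorrectorTensor 𝔚).isSmooth_slice ht) x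

/-- **The split of the oscillation error**: `ℛ div(w ⊗ w - R̄_q) = 𝒪₁ + 𝒪₂` on `[0,T]`
(linearity of `ℛ` on the smooth slices). [cite: BuckmasterEtAl2018, §6.1.3 (𝒪₁ + 𝒪₂)] -/
theorem antidivergence_oscillationSource_eq_add (𝔚 : MikadoDatum mikadoRadius) {t : ℝ}
    (ht : t ∈ Icc 0 S.T) :
    Torus.antidivergence (BDSV.oscillationSource P S 𝔚 η D t) =
      Torus.antidivergence (BDSV.oscPrincipalSource P S 𝔚 η D t) +
        Torus.antidivergence (BDSV.oscCorrectorSource P S 𝔚 η D t) := by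
  rw [h.oscillationSource_eq_add 𝔚 ht]
  exact Torus.antidivergence_add ((h.oscPrincipalSource 𝔚).isSmooth_slice ht)
    ((h.oscCorrectorSource 𝔚).isSmooth_slice ht)

end SmoothData

end Smooth

/-! ## The two named facts -/

section Facts

/-- `BDSV.oscillationErrorEstimate` is the stage fact (`BDSV.StageFact`) with body "the `C^{0,α}`
norms of `ℛ div(w ⊗ w - R̄_q)` on `[0,T]` are at most `C` times the scale of (6.1)"
(definitionally). [cite: BuckmasterEtAl2018, §6.1.3 (arXiv (6.12))] -/
theorem oscillationErrorEstimate_iff_stageFact :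
    oscillationErrorEstimate ↔ StageFact fun 𝔚 P C S _ _ 𝒟 =>
      HolderSupLE S.T (fun t => Torus.antidivergence (oscillationSource P S 𝔚 𝒟.cut.η 𝒟.D t))
        0 (Real.toNNReal P.α)
        (C * (Real.sqrt (amp P.β P.a P.b (S.q + 1)) * Real.sqrt (amp P.β P.a P.b S.q) *
          freq P.a P.b S.q * freq P.a P.b (S.q + 1) ^ (-1 + 4 * P.α))) :=
  Iff.rfl

/-- **The principal oscillation term `𝒪₁`** (BDSV §6.1.3, arXiv (6.11): with
`𝒪₁ = ℛ div(-R̄_q + Σ_i w_{o,i} ⊗ w_{o,i})` (disjoint supports of the `η_i`), the expansion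
arXiv (6.10) `w_{o,i} ⊗ w_{o,i} = R_{q,i} + Σ_{k≠0} ρ_{q,i} ∇Φ_i⁻¹ C_k(R̃_{q,i}) ∇Φ_i⁻ᵀ e^{iλ_{q+1}k·Φ_i}`
and `∇Φ_i⁻¹ C_k ∇Φ_i⁻ᵀ ∇Φ_iᵀ k = 0`, "by Proposition C.2,
`‖𝒪₁‖_α ≲ Σ_i Σ_{k≠0} ‖div(ρ_{q,i}∇Φ_i⁻¹C_k(R̃_{q,i})∇Φ_i⁻ᵀ)‖₀/λ_{q+1}^{1-α} + [terms of order N]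
≲ Σ_i Σ_{k≠0} δ_{q+1}/(ℓλ_{q+1}^{1-α}|k|⁶) ≲ δ_{q+1}^{1/2}δ_q^{1/2}λ_q/λ_{q+1}^{1-α}`", with "a large
choice of `N`"). Transcription: along `BDSV.StageFact`, for `𝒪₁ = ℛ(BDSV.oscPrincipalSource)` built
on `w_o = BDSV.principalPart`, the `C^{0,α}` norms on `[0,T]` (`BDSV.HolderSupLE … 0 α`) are at
most `C δ_{q+1}^{1/2} δ_q^{1/2} λ_q λ_{q+1}^{-(1-4α)}` — the exponent of (6.1), implied by the printed
display up to the factor `λ_q^{3α/2} ≤ λ_{q+1}^{3α/2}` it tacitly absorbs (module docstring).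
[cite: BuckmasterEtAl2018, §6.1.3 (arXiv (6.11)) with Prop. 6.1 (6.1)] -/
def oscillationPrincipalEstimate : Prop :=
  StageFact fun 𝔚 P C S _ _ 𝒟 =>
    HolderSupLE S.T (fun t => Torus.antidivergence (oscPrincipalSource P S 𝔚 𝒟.cut.η 𝒟.D t))
      0 (Real.toNNReal P.α)
      (C * (Real.sqrt (amp P.β P.a P.b (S.q + 1)) * Real.sqrt (amp P.β P.a P.b S.q) *
        freq P.a P.b S.q * freq P.a P.b (S.q + 1) ^ (-1 + 4 * P.α)))

/-- **The corrector oscillation term `𝒪₂`** (BDSV §6.1.3, arXiv (6.9): "`‖𝒪₂‖_α ≲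
‖w_o ⊗ w_c + w_c ⊗ w_o + w_c ⊗ w_c‖_α ≲ ‖w_o‖₀‖w_c‖_α + ‖w_o‖_α‖w_c‖₀ + ‖w_c‖_α² ≲ δ_{q+1}/(ℓλ_{q+1}^{1-α})
≲ δ_{q+1}^{1/2}δ_q^{1/2}λ_q/λ_{q+1}^{1-α}`", by the Calderón–Zygmund bound for `ℛ div` (Prop. C.1)
and the bounds of Cor. 5.8 on `w_o`, `w_c`). Transcription as in `BDSV.oscillationPrincipalEstimate`,
for `𝒪₂ = ℛ(BDSV.oscCorrectorSource)` built on `w_o = BDSV.principalPart`, `w_c = BDSV.correctorPart`.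
[cite: BuckmasterEtAl2018, §6.1.3 (arXiv (6.9)) with Prop. 6.1 (6.1)] -/
def oscillationCorrectorEstimate : Prop :=
  StageFact fun 𝔚 P C S _ _ 𝒟 =>
    HolderSupLE S.T (fun t => Torus.antidivergence (oscCorrectorSource P S 𝔚 𝒟.cut.η 𝒟.D t))
      0 (Real.toNNReal P.α)
      (C * (Real.sqrt (amp P.β P.a P.b (S.q + 1)) * Real.sqrt (amp P.β P.a P.b S.q) *
        freq P.a P.b S.q * freq P.a P.b (S.q + 1) ^ (-1 + 4 * P.α)))

end Facts

/-! ## Assembly: (6.9) and (6.11) give (6.12) -/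

section Assembly

/-- From two `C^{0,α}` bounds `B₁, B₂` on `[0,T]` for two families of smooth fields to the bound
`max B₁ 0 + max B₂ 0` for their sum. [folklore] -/
theorem HolderSupLE.add {F : Type*} [NormedAddCommGroup F] [NormedSpace ℝ F] {T : ℝ}
    {f g : ℝ → 𝕋³ → F} {r : ℝ≥0} {B₁ B₂ : ℝ}
    (hf : HolderSupLE T f 0 r B₁) (hg : HolderSupLE T g 0 r B₂)
    (hfs : ∀ t ∈ Icc 0 T, IsSmooth (f t)) (hgs : ∀ t ∈ Icc 0 T, IsSmooth (g t)) :
    HolderSupLE T (fun t => f t + g t) 0 r (max B₁ 0 + max B₂ 0) := by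
  intro t ht
  refine (FunctionSpaces.Torus.eContDiffHolderNorm_add_le (k := 0) ((hfs t ht).isContDiff (by simp))
    ((hgs t ht).isContDiff (by simp))).trans ?_
  rw [ENNReal.ofReal_add (le_max_right _ _) (le_max_right _ _)]
  exact add_le_add ((hf t ht).trans (ENNReal.ofReal_le_ofReal (le_max_left _ _)))
    ((hg t ht).trans (ENNReal.ofReal_le_ofReal (le_max_left _ _)))

/-- **Assembly of the oscillation error from its two parts** (BDSV §6.1.3: "Clearly, (6.9) and
(6.11) give (6.12)"): the estimates of `𝒪₁` and `𝒪₂` imply `BDSV.oscillationErrorEstimate`, with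
the extremal thresholds of the two facts together with `α < βb(b-1)` and the threshold of
`BDSV.exists_threshold_amp_succ_succ` (making `ρ_q > 0`, so that the construction is smooth and
`ℛ div` splits), and the constant `max(C₁,0) + max(C₂,0)`. [cite: BuckmasterEtAl2018, §6.1.3 (arXiv (6.12))] -/
theorem oscillationErrorEstimate_of_parts (h₁ : oscillationPrincipalEstimate)
    (h₂ : oscillationCorrectorEstimate) : oscillationErrorEstimate := by
  intro 𝔚 c₀ hc₀ Cη β hβ hβ' b hb hb'
  obtain ⟨α₁, hα₁, h₁⟩ := h₁ 𝔚 c₀ hc₀ Cη β hβ hβ' b hb hb'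
  obtain ⟨α₂, hα₂, h₂⟩ := h₂ 𝔚 c₀ hc₀ Cη β hβ hβ' b hb hb'
  have hαρ : 0 < β * b * (b - 1) := mul_pos (mul_pos hβ (by linarith)) (by linarith)
  refine ⟨min (min α₁ α₂) (β * b * (b - 1)), lt_min (lt_min hα₁ hα₂) hαρ, ?_⟩
  intro α hα hαlt
  have hα12 : α < min α₁ α₂ := lt_of_lt_of_le hαlt (min_le_left _ _)
  have hαρ' : α < 2 * β * b * (b - 1) := by
    have := lt_of_lt_of_le hαlt (min_le_right _ _)
    nlinarith
  obtain ⟨N₁, h₁⟩ := h₁ α hα (lt_of_lt_of_le hα12 (min_le_left _ _))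
  obtain ⟨N₂, h₂⟩ := h₂ α hα (lt_of_lt_of_le hα12 (min_le_right _ _))
  refine ⟨max N₁ N₂, fun Cin C₀ => ?_⟩
  obtain ⟨C₁, a₁, ha₁, h₁⟩ := h₁ Cin C₀
  obtain ⟨C₂, a₂, ha₂, h₂⟩ := h₂ Cin C₀
  obtain ⟨aρ, haρ, hρ⟩ := exists_threshold_amp_succ_succ hb hαρ'
  refine ⟨max C₁ 0 + max C₂ 0, max (max a₁ a₂) aρ, lt_max_of_lt_left (lt_max_of_lt_left ha₁), ?_⟩
  intro a ha S H 𝒟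
  have ha12 : max a₁ a₂ ≤ a := le_trans (le_max_left _ _) ha
  have ha₁' : a₁ ≤ a := le_trans (le_max_left _ _) ha12
  have ha₂' : a₂ ≤ a := le_trans (le_max_right _ _) ha12
  have haρ' : aρ ≤ a := le_trans (le_max_right _ _) ha
  have ha1 : (1 : ℝ) ≤ a := le_trans ha₁.le ha₁'
  have e₁ := h₁ a ha₁' S (H.of_le (le_max_left _ _)) 𝒟
  have e₂ := h₂ a ha₂' S (H.of_le (le_max_right _ _)) 𝒟
  have hsm : SmoothData ⟨β, α, a, b⟩ S 𝒟.cut.η 𝒟.D := H.smoothData ha1 (hρ a haρ' S.q) hc₀ 𝒟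
  have hs := stressScale_nonneg (β := β) (α := α) (b := b) ha1 S.q
  have key := HolderSupLE.add e₁ e₂
    (fun t ht => Torus.isSmooth_antidivergence ((hsm.oscPrincipalSource 𝔚).isSmooth_slice ht))
    (fun t ht => Torus.isSmooth_antidivergence ((hsm.oscCorrectorSource 𝔚).isSmooth_slice ht))
  intro t ht
  beta_reduce
  rw [hsm.antidivergence_oscillationSource_eq_add 𝔚 ht]
  refine (key t ht).trans (ENNReal.ofReal_le_ofReal ?_)
  rw [add_mul]
  exact add_le_add (max_mul_le_max_mul hs) (max_mul_le_max_mul hs)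

end Assembly

end BDSV

end Literature.Analysis.FluidPDE
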